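import Literature.Computability.Cryptography.BLPRSReduction
import Literature.Computability.Cryptography.LWEBinaryHybrids
import Mathlib.InformationTheory.Hamming
import HarnessLib

/-!
# BLPRS 2013, §3–§4 in the regime of pqc.S21: the parameters of the rate-guess test and their eventual admissibility

Topic `Computability/Cryptography` (LWE), grouping namespace `BLPRS2013`. Proved glue (no named fact)
towards `Literature.Computability.Cryptography.blprs_gapSVP_sqrt_dim_to_lwe_classical` (**pqc.S21**),
hypothesis `h₃` of `BLPRSReduction.lean`: the CONCRETE parameter functions of `n` with which the law-level
chain of `BLPRSSection4Assembly.lean` (`section4_selected`) is run in the regime of pqc.S21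
(`d = ⌊√n⌋`, `Q = 2^{⌊d/2⌋+2}`, `α₂ = α/(8d)`, target modulus `q' = q(n)`, target rate `α(n)`, quality
`ε = ξ = n^{-c}`), and the proofs that the hypotheses of that chain hold for all large `n`:

* the Hamming weight `hammingNorm` of a residue vector; for a binary `z` (and `Q > 1`),
  `‖z‖² = hammingNorm(z̄)` (`norm_sq_intVecToEuclidean_of_binary`) and `‖z‖ ≤ √n`;
* the printed parameters (p. 14, Lemma 4.7: `extLWE` width `√(ξ²α² + r²) = √5·α₂` with `ξ = 2`, `r = α₂`;
  p. 16, Lemma 4.9: `γ = √n·β`, `α' = √(β²‖z‖² + γ²)`; p. 13 / Cor. 3.2: `r = q'⁻¹√(2 ln(2n(1+1/ξ))/π)`):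
  `switchRadius q c n`, `binNoiseRate α n s = √(5α₂²(hammingNorm s + n))` (the rate of the `binLWE` noise for the secret `s`),
  the guesses `guessRaise q α c n w = √(α² - (5α₂² + r²)(w + n))`, `w ≤ n`, and the estimation sizes
  `advThreshold c₃ n = 1/(4n^{c₃})` (`θ`, a quarter of the promised advantage `1/n^{c₃}`),
  `batches c₃ n = 1024 (n+2) n^{2c₃}` (`N = N'`);
* **`switchRadius_spec`** (the smoothing hypothesis `hr` of the switch, given `q n ≤ Q`),
  **`estimation_error_le`** (`(G+1)·4/(Nθ²) + 8/(N'θ²) ≤ 1/8` with `G = n + 1` guesses),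
  **`eventually_guess_budget`** (`(5α₂² + r²)·2n ≤ α²`: `eventually_noise_budget` + `eventually_modSwitch_budget`),
  **`sqrt_switched_raised_eq`** / **`eventually_guess_exact`** (for every binary `z` the guess `w = hammingNorm(z̄)` makes
  the switched-and-raised rate EXACTLY `α(n)`: `√(√(ρ₀² + r²(‖z‖² + n))² + τ_w²) = α`),
  `binNoiseRate_ge` (`ρ₀ ≥ √(5n)·α₂ = α₀ > 0`), and the generic domination lemmas `eventually_polyBounded_le_pow`,
  **`eventually_eps_terms`** (`m₃(n)·(4ε) ≤ θ/2` and `m₃(14ε) ≤ θ` for `ε = n^{-c}`, `c` large) and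
  **`eventually_modulus_term`** (`m₃ · 2/(α₀ Q) ≤ θ/2`: exponential beats polynomial).

## References

* Z. Brakerski, A. Langlois, C. Peikert, O. Regev, D. Stehlé, *Classical hardness of learning with errors*,
  STOC 2013; arXiv:1306.0281, p. 13 (parameters of the formal Thm. 1.1), Cor. 3.2, Lemma 2.15, Lemma 4.7
  (p. 14), Lemma 4.9 (p. 16), Thm. 4.1. [BrakerskiEtAl2013]
-/

noncomputable section

open Filter Literature.Algebra.EuclideanLattices Literature.Computability.Complexity
open scoped Real

namespace Literature.Computability.Cryptography

namespace BLPRS2013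

open LWE

/-! ### Hamming weight of the secret -/

section Weight

variable {n Q : ℕ}

/-- For a binary integer vector and `Q > 1`, the weight of `z̄` counts the ones of `z`. [folklore] -/
theorem hammingNorm_intCastVec_of_binary (hQ : 1 < Q) {z : Fin n → ℤ} (hz : ∀ j, z j = 0 ∨ z j = 1) :
    hammingNorm (intCastVec z : Fin n → ZMod Q) = (Finset.univ.filter fun j => z j = 1).card := by
  unfold hammingNorm
  congr 1
  refine Finset.filter_congr fun j _ => ?_
  haveI : Fact (1 < Q) := ⟨hQ⟩
  rcases hz j with h | h
  · simp [intCastVec, h]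
  · simp [intCastVec, h]

/-- **`‖z‖² = hammingNorm(z̄)` for binary `z`** (`Q > 1`). [cite: BrakerskiEtAl2013, Lemma 4.9 (proof)] -/
theorem norm_sq_intVecToEuclidean_of_binary (hQ : 1 < Q) {z : Fin n → ℤ} (hz : ∀ j, z j = 0 ∨ z j = 1) :
    ‖intVecToEuclidean n z‖ ^ 2 = hammingNorm (intCastVec z : Fin n → ZMod Q) := by
  rw [hammingNorm_intCastVec_of_binary hQ hz, norm_intVecToEuclidean, Real.sq_sqrt (Finset.sum_nonneg fun j _ => sq_nonneg _)]
  rw [Finset.card_eq_sum_ones, Nat.cast_sum, Finset.sum_filter]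
  push_cast
  refine Finset.sum_congr rfl fun j _ => ?_
  rcases hz j with h | h <;> simp [h]

/-- `‖z‖ ≤ √n` for binary `z` ("Using `‖z‖ ≤ √n`", p. 16). [cite: BrakerskiEtAl2013, Lemma 4.9 (proof)] -/
theorem norm_intVecToEuclidean_le_sqrt_of_binary {z : Fin n → ℤ} (hz : ∀ j, z j = 0 ∨ z j = 1) :
    ‖intVecToEuclidean n z‖ ≤ Real.sqrt n := by
  rw [norm_intVecToEuclidean]
  refine Real.sqrt_le_sqrt ?_
  calc ∑ j, ((z j : ℝ)) ^ 2 ≤ ∑ _j : Fin n, (1 : ℝ) := Finset.sum_le_sum fun j _ => by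
        rcases hz j with h | h <;> simp [h]
    _ = n := by simp

end Weight

/-! ### The exactness identity of the right guess -/

/-- **The right guess makes the rate exact**: if `ρ² + r²(B₁ + B₂) = S ≤ α²` and `τ = √(α² - S)`, then
`√(√(ρ² + r²(B₁ + B₂))² + τ²) = α`. [cite: BrakerskiEtAl2013, Lemma 2.15 (finite-guess form) with Cor. 3.2] -/
theorem sqrt_switched_raised_eq {α ρ r B₁ B₂ S : ℝ} (hα : 0 ≤ α) (hS : ρ ^ 2 + r ^ 2 * (B₁ + B₂) = S)
    (hS0 : 0 ≤ S) (hSα : S ≤ α ^ 2) :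
    Real.sqrt (Real.sqrt (ρ ^ 2 + r ^ 2 * (B₁ + B₂)) ^ 2 + Real.sqrt (α ^ 2 - S) ^ 2) = α := by
  rw [hS, Real.sq_sqrt hS0, Real.sq_sqrt (by linarith), show S + (α ^ 2 - S) = α ^ 2 by ring, Real.sqrt_sq hα]

/-! ### The parameter functions of pqc.S21's `h₃` -/

section Params

variable {q : ℕ → ℕ} {α : ℕ → ℝ}

variable (q) in
/-- **The switch radius** `r = q'⁻¹·√(2 ln(2n(1+n^c))/π)` (Cor. 3.2 with `ε = ξ = n^{-c}`, `q' = q(n) ≤ Q`).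
[cite: BrakerskiEtAl2013, Cor. 3.2 and p. 13] -/
def switchRadius (c n : ℕ) : ℝ :=
  ((q n : ℝ))⁻¹ * Real.sqrt (2 * Real.log (2 * n * (1 + (n : ℝ) ^ c)) / π)

variable (α) in
/-- **The `binLWE` rate for the secret `s`**: `ρ₀(s) = √(5α₂²(hammingNorm s + n))` (`= √(β²‖z‖² + γ²)` with
`β = √5·α₂`, `γ = √n·β`, p. 16, for binary `z` with `z̄ = s`). [cite: BrakerskiEtAl2013, Lemma 4.9 with Lemma 4.7 (`β = √(ξ²α² + r²) = √5·α`)] -/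
def binNoiseRate (n : ℕ) (s : Fin n → ZMod (modulus n)) : ℝ :=
  Real.sqrt (5 * rate₂ α n ^ 2 * ((hammingNorm s : ℝ) + n))

variable (q α) in
/-- **The noise raising of guess `w`**: `τ_w = √(α² - (5α₂² + r²)(w + n))`.
[cite: BrakerskiEtAl2013, Lemma 2.15 (proof sketch: "add noise") with Cor. 3.2] -/
def guessRaise (c n : ℕ) (w : Fin (n + 1)) : ℝ :=
  Real.sqrt (α n ^ 2 - (5 * rate₂ α n ^ 2 + switchRadius q c n ^ 2) * ((w : ℕ) + n))

/-- **The estimation threshold** `θ = 1/(4n^{c₃})` (a quarter of the promised advantage). [cite: BrakerskiEtAl2013, Lemma 2.15 (proof sketch)] -/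
def advThreshold (c₃ n : ℕ) : ℝ := 1 / (4 * (n : ℝ) ^ c₃)

/-- **The number of batches per guess (and of reference runs)** `N = N' = 1024(n+2)n^{2c₃}`.
[cite: BrakerskiEtAl2013, Lemma 2.15 (proof sketch: "Chernoff bound")] -/
def batches (c₃ n : ℕ) : ℕ := 1024 * (n + 2) * n ^ (2 * c₃)

/-- `θ > 0` for `n ≥ 1`. [folklore] -/
theorem advThreshold_pos {c₃ n : ℕ} (hn : 0 < n) : 0 < advThreshold c₃ n := by
  unfold advThreshold
  have : (0 : ℝ) < n := by exact_mod_cast hn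
  positivity

/-- `N > 0` for `n ≥ 1`. [folklore] -/
theorem batches_pos {c₃ n : ℕ} (hn : 0 < n) : 0 < batches c₃ n := by
  unfold batches
  positivity

/-- **The estimation error is at most `1/8`**: with `G = n + 1` guesses, `N = N' = batches`, `θ = advThreshold`,
`(G+1)·4/(Nθ²) + 8/(N'θ²) ≤ 1/8`. [cite: BrakerskiEtAl2013, Lemma 2.15 (proof sketch)] -/
theorem estimation_error_le {c₃ n : ℕ} (hn : 0 < n) :
    ((((n + 1 : ℕ) : ℕ) : ℝ) + 1) * (4 / ((batches c₃ n : ℝ) * advThreshold c₃ n ^ 2)) +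
        8 / ((batches c₃ n : ℝ) * advThreshold c₃ n ^ 2) ≤ 1 / 8 := by
  have hn' : (0 : ℝ) < n := by exact_mod_cast hn
  have hpow : (0 : ℝ) < (n : ℝ) ^ c₃ := by positivity
  have hkey : (batches c₃ n : ℝ) * advThreshold c₃ n ^ 2 = 64 * ((n : ℝ) + 2) := by
    unfold batches advThreshold
    push_cast
    field_simp
    ring
  rw [hkey]
  push_cast
  have h2 : (0 : ℝ) < (n : ℝ) + 2 := by linarith
  have e1 : ((n : ℝ) + 1 + 1) * (4 / (64 * ((n : ℝ) + 2))) = 1 / 16 := by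
    field_simp
    ring
  have e2 : 8 / (64 * ((n : ℝ) + 2)) ≤ 1 / 16 := by
    rw [div_le_div_iff₀ (by positivity) (by norm_num)]
    nlinarith
  rw [e1]
  linarith

/-- **The smoothing hypothesis of the switch holds by construction** (`q(n) ≤ Q`): with `ε = n^{-c}`,
`max(Q⁻¹, q⁻¹)·√(2 ln(2n(1+1/ε))/π) ≤ switchRadius`. [cite: BrakerskiEtAl2013, Cor. 3.2] -/
theorem switchRadius_spec {c n : ℕ} (hq0 : 0 < q n) (hqQ : q n ≤ modulus n) :
    max ((modulus n : ℝ))⁻¹ ((q n : ℝ))⁻¹ * Real.sqrt (2 * Real.log (2 * n * (1 + 1 / (1 / (n : ℝ) ^ c))) / π) ≤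
      switchRadius q c n := by
  unfold switchRadius
  rw [one_div_one_div]
  refine mul_le_mul_of_nonneg_right ?_ (Real.sqrt_nonneg _)
  refine max_le ?_ le_rfl
  have hq0' : (0 : ℝ) < q n := by exact_mod_cast hq0
  exact inv_anti₀ hq0' (by exact_mod_cast hqQ)

/-- **The guess budget**: eventually `(5α₂² + r²)·(2n) ≤ α²` (the `binLWE` part by `eventually_noise_budget`,
`10nα₂² ≤ α²/2`; the switch part by `eventually_modSwitch_budget`, `2nr² = (4n/(πq²)) ln(2n(1+n^c)) ≤ α²/2`).
[cite: BrakerskiEtAl2013, p. 13 (`β² = 10nα² + (4n/(πq'²)) ln(2n(1+1/ξ)) ≤ α²`)] -/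
theorem eventually_guess_budget (c : ℕ)
    (hα : ∀ᶠ n : ℕ in atTop, 0 < α n ∧ α n < 1 ∧ Real.sqrt n * Real.log n ≤ α n * q n) :
    ∀ᶠ n : ℕ in atTop, (5 * rate₂ α n ^ 2 + switchRadius q c n ^ 2) * (2 * n) ≤ α n ^ 2 := by
  filter_upwards [eventually_noise_budget α, eventually_modSwitch_budget c hα, eventually_inv_rate_le hα,
    eventually_ge_atTop 1] with n h1 h2 h3 h4
  obtain ⟨hα0, -, h1αq, -⟩ := h3
  have hn1 : (1 : ℝ) ≤ n := by exact_mod_cast h4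
  have hq0 : (0 : ℝ) < q n := by
    by_contra h
    push Not at h
    nlinarith
  have hlog0 : 0 ≤ 2 * Real.log (2 * n * (1 + (n : ℝ) ^ c)) / π := by
    refine div_nonneg (mul_nonneg (by norm_num) (Real.log_nonneg ?_)) Real.pi_pos.le
    have : (0 : ℝ) ≤ (n : ℝ) ^ c := by positivity
    nlinarith
  have hr2 : switchRadius q c n ^ 2 * (2 * n) = 4 * n / (Real.pi * (q n) ^ 2) * Real.log (2 * n * (1 + (n : ℝ) ^ c)) := by
    unfold switchRadius
    rw [mul_pow, Real.sq_sqrt hlog0, inv_pow]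
    field_simp
    ring
  have hsw : switchRadius q c n ^ 2 * (2 * n) ≤ α n ^ 2 / 2 := by
    rw [hr2]
    have hpi := Real.pi_pos
    have hq2 : (0 : ℝ) < (q n : ℝ) ^ 2 := by positivity
    -- `h2 : 8n/π · log ≤ (αq)²`; divide by `2q²`
    rw [show 4 * (n : ℝ) / (Real.pi * (q n : ℝ) ^ 2) * Real.log (2 * n * (1 + (n : ℝ) ^ c)) =
      (8 * n / Real.pi * Real.log (2 * n * (1 + (n : ℝ) ^ c))) / (2 * (q n : ℝ) ^ 2) by field_simp; ring]
    rw [div_le_div_iff₀ (by positivity) (by norm_num : (0 : ℝ) < 2)]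
    calc 8 * (n : ℝ) / Real.pi * Real.log (2 * n * (1 + (n : ℝ) ^ c)) * 2 ≤ (α n * q n) ^ 2 * 2 :=
          mul_le_mul_of_nonneg_right h2 (by norm_num)
      _ = α n ^ 2 * (2 * (q n : ℝ) ^ 2) := by ring
  have h5 : 5 * rate₂ α n ^ 2 * (2 * n) ≤ α n ^ 2 / 2 := by nlinarith [h1]
  nlinarith [hsw, h5]

/-- **`ρ₀ ≥ α₀ := √(5n)·α₂`** (the weight-`0` rate; `γ = √n·β`). [cite: BrakerskiEtAl2013, Lemma 4.9] -/
theorem binNoiseRate_ge {n : ℕ} (hα₂ : 0 ≤ rate₂ α n) (s : Fin n → ZMod (modulus n)) :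
    Real.sqrt (5 * n) * rate₂ α n ≤ binNoiseRate α n s := by
  unfold binNoiseRate
  have h0 : 0 ≤ Real.sqrt (5 * n) * rate₂ α n := by positivity
  rw [← Real.sqrt_sq h0]
  refine Real.sqrt_le_sqrt ?_
  rw [mul_pow, Real.sq_sqrt (by positivity)]
  nlinarith [sq_nonneg (rate₂ α n), Nat.cast_nonneg (α := ℝ) (hammingNorm s)]

/-- `binNoiseRate² = 5α₂²(hammingNorm + n)`. [folklore] -/
theorem binNoiseRate_sq {n : ℕ} (s : Fin n → ZMod (modulus n)) : binNoiseRate α n s ^ 2 = 5 * rate₂ α n ^ 2 * ((hammingNorm s : ℝ) + n) := by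
  unfold binNoiseRate
  exact Real.sq_sqrt (by positivity)

/-- `1 < Q`. [folklore] -/
theorem one_lt_modulus (n : ℕ) : 1 < modulus n := by
  unfold modulus
  exact Nat.one_lt_two_pow (by omega)

/-- **For every binary secret the right guess is exact** (eventually in `n`): for `z ∈ {0,1}ⁿ` and
`w := hammingNorm(z̄)`, `√(√(ρ₀(z̄)² + r²(‖z‖² + (√n)²))² + τ_w²) = α(n)`.
[cite: BrakerskiEtAl2013, Lemma 2.15 with Cor. 3.2 (p. 13)] -/
theorem eventually_guess_exact (c : ℕ)
    (hα : ∀ᶠ n : ℕ in atTop, 0 < α n ∧ α n < 1 ∧ Real.sqrt n * Real.log n ≤ α n * q n) :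
    ∀ᶠ n : ℕ in atTop, ∀ z : Fin n → ℤ, (∀ j, z j = 0 ∨ z j = 1) →
      Real.sqrt (Real.sqrt (binNoiseRate α n (intCastVec z) ^ 2 +
          switchRadius q c n ^ 2 * (‖intVecToEuclidean n z‖ ^ 2 + Real.sqrt n ^ 2)) ^ 2 +
        guessRaise q α c n ⟨hammingNorm (intCastVec z : Fin n → ZMod (modulus n)), Nat.lt_succ_of_le ((hammingNorm_le_card_fintype).trans_eq (Fintype.card_fin n))⟩ ^ 2) = α n := by
  filter_upwards [eventually_guess_budget c hα, hα] with n hbud hn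
  intro z hz
  have hw : hammingNorm (intCastVec z : Fin n → ZMod (modulus n)) ≤ n :=
    (hammingNorm_le_card_fintype).trans_eq (Fintype.card_fin n)
  have hnorm := norm_sq_intVecToEuclidean_of_binary (one_lt_modulus n) hz
  set w := hammingNorm (intCastVec z : Fin n → ZMod (modulus n)) with hwdef
  have hS : binNoiseRate α n (intCastVec z) ^ 2 + switchRadius q c n ^ 2 * (‖intVecToEuclidean n z‖ ^ 2 + Real.sqrt n ^ 2) =
      (5 * rate₂ α n ^ 2 + switchRadius q c n ^ 2) * ((w : ℝ) + n) := by
    rw [binNoiseRate_sq, hnorm, Real.sq_sqrt (Nat.cast_nonneg n)]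
    ring
  have hS0 : 0 ≤ (5 * rate₂ α n ^ 2 + switchRadius q c n ^ 2) * ((w : ℝ) + n) := by positivity
  have hSα : (5 * rate₂ α n ^ 2 + switchRadius q c n ^ 2) * ((w : ℝ) + n) ≤ α n ^ 2 := by
    refine le_trans (mul_le_mul_of_nonneg_left ?_ (by positivity)) hbud
    have : (w : ℝ) ≤ n := by exact_mod_cast hw
    linarith
  unfold guessRaise
  exact sqrt_switched_raised_eq hn.1.le hS hS0 hSα

/-! ### Domination lemmas: the `ε`-terms and the modulus term -/

/-- **A polynomially bounded function times a fixed power is eventually below a larger power.** [folklore] -/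
theorem eventually_polyBounded_le_pow {m : ℕ → ℕ} (hm : IsPolyBounded m) (A : ℝ) (k₀ : ℕ) :
    ∃ c : ℕ, ∀ᶠ n : ℕ in atTop, A * (m n : ℝ) * (n : ℝ) ^ k₀ ≤ (n : ℝ) ^ c := by
  obtain ⟨p, hp⟩ := hm
  obtain ⟨C, k, hCk⟩ := exists_eval_le_mul_pow_add p
  refine ⟨k + k₀ + 1, ?_⟩
  filter_upwards [eventually_ge_atTop (max 1 (Nat.ceil (|A| * (2 * C))))] with n hn
  have hn1 : 1 ≤ n := le_of_max_le_left hn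
  have hn1' : (1 : ℝ) ≤ n := by exact_mod_cast hn1
  have hnA : |A| * (2 * C) ≤ n := le_trans (Nat.le_ceil _) (by exact_mod_cast le_of_max_le_right hn)
  have hmle : (m n : ℝ) ≤ 2 * C * (n : ℝ) ^ k := by
    have h1 : (m n : ℝ) ≤ C * (n : ℝ) ^ k + C := by exact_mod_cast (hp n).trans (hCk n)
    have h2 : (C : ℝ) ≤ C * (n : ℝ) ^ k := by
      have : (1 : ℝ) ≤ (n : ℝ) ^ k := one_le_pow₀ hn1'
      have hC : (0 : ℝ) ≤ C := by positivity
      nlinarith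
    linarith
  calc A * (m n : ℝ) * (n : ℝ) ^ k₀ ≤ |A| * (m n : ℝ) * (n : ℝ) ^ k₀ := by
        gcongr
        exact le_abs_self A
    _ ≤ |A| * (2 * C * (n : ℝ) ^ k) * (n : ℝ) ^ k₀ := by gcongr
    _ = (|A| * (2 * C)) * (n : ℝ) ^ (k + k₀) := by ring
    _ ≤ n * (n : ℝ) ^ (k + k₀) := by gcongr
    _ = (n : ℝ) ^ (k + k₀ + 1) := by ring

/-- **The `ε`-terms fit**: for `ε = n^{-c}` with `c` large (depending on the polynomial bound of `m₃` and on
`c₃`), eventually `m₃·(4ε) ≤ θ/2` and `m₃·(14ε) ≤ θ`, `θ = 1/(4n^{c₃})`. [cite: BrakerskiEtAl2013, p. 13 (`ξ = 1/poly`, loss `14ξm`)] -/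
theorem eventually_eps_terms {m₃ : ℕ → ℕ} (hm : IsPolyBounded m₃) (c₃ : ℕ) :
    ∃ c : ℕ, ∀ᶠ n : ℕ in atTop, (m₃ n : ℝ) * (4 * (1 / (n : ℝ) ^ c)) ≤ advThreshold c₃ n / 2 ∧
      (m₃ n : ℝ) * (14 * (1 / (n : ℝ) ^ c)) ≤ advThreshold c₃ n := by
  obtain ⟨c, hc⟩ := eventually_polyBounded_le_pow hm 56 c₃
  refine ⟨c, ?_⟩
  filter_upwards [hc, eventually_ge_atTop 1] with n hn h1
  have hn0 : (0 : ℝ) < n := by exact_mod_cast h1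
  have hpc : (0 : ℝ) < (n : ℝ) ^ c := by positivity
  have hp3 : (0 : ℝ) < (n : ℝ) ^ c₃ := by positivity
  unfold advThreshold
  have e1 : (m₃ n : ℝ) * (4 * (1 / (n : ℝ) ^ c)) = 4 * (m₃ n : ℝ) / (n : ℝ) ^ c := by ring
  have e2 : (m₃ n : ℝ) * (14 * (1 / (n : ℝ) ^ c)) = 14 * (m₃ n : ℝ) / (n : ℝ) ^ c := by ring
  have e3 : 1 / (4 * (n : ℝ) ^ c₃) / 2 = 1 / (8 * (n : ℝ) ^ c₃) := by ring
  constructor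
  · rw [e1, e3, div_le_div_iff₀ hpc (by positivity)]
    nlinarith
  · rw [e2, div_le_div_iff₀ hpc (by positivity)]
    nlinarith

/-- **The modulus term is negligible**: eventually `m₃ · (2/(α₀Q)) ≤ θ/2` with `α₀ = √(5n)·α₂ ≥ α₂ ≥ 1/(8nq(n))`
and `Q = 2^{⌊d/2⌋+2}` (exponential beats polynomial, `eventually_mul_eval_le_two_pow_half_dim`).
[cite: BrakerskiEtAl2013, p. 13 with RegevLWE2009, Lemma 4.3 (discretisation error `∝ 1/(αq)`)] -/
theorem eventually_modulus_term {m₃ : ℕ → ℕ} (hq : IsPolyBounded q) (hm : IsPolyBounded m₃) (c₃ : ℕ)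
    (hα : ∀ᶠ n : ℕ in atTop, 0 < α n ∧ α n < 1 ∧ Real.sqrt n * Real.log n ≤ α n * q n) :
    ∀ᶠ n : ℕ in atTop, (m₃ n : ℝ) * (2 / (Real.sqrt (5 * n) * rate₂ α n * modulus n)) ≤ advThreshold c₃ n / 2 := by
  obtain ⟨pq, hpq⟩ := hq
  obtain ⟨pm, hpm⟩ := hm
  -- `128 · m₃ · n^{c₃} · (8 n q) ≤ 2^{⌊d/2⌋} ≤ Q/4`
  have hexp := eventually_mul_eval_le_two_pow_half_dim
    (Polynomial.C 1024 * Polynomial.X ^ (c₃ + 1) * pm * pq) 1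
  filter_upwards [hexp, eventually_inv_rate_le hα, eventually_ge_atTop 1] with n hexpn hinv h1
  obtain ⟨hα0, hα1, h1αq, hinvq⟩ := hinv
  have hn1 : (1 : ℝ) ≤ n := by exact_mod_cast h1
  have hn0 : (0 : ℝ) < n := by linarith
  have hd1 : 1 ≤ dim n := Nat.sqrt_pos.2 h1
  have hd : (1 : ℝ) ≤ dim n := by exact_mod_cast hd1
  have hdn : (dim n : ℝ) ≤ n := by exact_mod_cast Nat.sqrt_le_self n
  have hq0 : (0 : ℝ) < q n := by
    by_contra h; push Not at h; nlinarith
  -- `α₂ ≥ 1/(8 n q)`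
  have hα₂ : 1 / (8 * n * q n) ≤ rate₂ α n := by
    unfold rate₂
    rw [div_le_div_iff₀ (by positivity) (by positivity)]
    have : 1 ≤ α n * q n := h1αq
    nlinarith [mul_le_mul_of_nonneg_left hdn (by positivity : (0 : ℝ) ≤ 8 * α n * q n)]
  have hα₂pos : 0 < rate₂ α n := lt_of_lt_of_le (by positivity) hα₂
  -- `Q ≥ 4 · 2^{⌊d/2⌋}`
  have hQ : (4 : ℝ) * (2 : ℝ) ^ (dim n / 2) = modulus n := by
    unfold modulus
    push_cast
    rw [pow_add]
    norm_num
    ring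
  have hsqrt : (1 : ℝ) ≤ Real.sqrt (5 * n) := by
    rw [show (1 : ℝ) = Real.sqrt 1 by simp]
    exact Real.sqrt_le_sqrt (by linarith)
  have hexpn' : 1024 * (n : ℝ) ^ (c₃ + 1) * (m₃ n : ℝ) * (q n : ℝ) ≤ (2 : ℝ) ^ (dim n / 2) := by
    rw [one_mul] at hexpn
    have hev : (((Polynomial.C 1024 * Polynomial.X ^ (c₃ + 1) * pm * pq).eval n : ℕ) : ℝ) =
        1024 * (n : ℝ) ^ (c₃ + 1) * ((pm.eval n : ℕ) : ℝ) * ((pq.eval n : ℕ) : ℝ) := by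
      simp only [Polynomial.eval_mul, Polynomial.eval_C, Polynomial.eval_X, Polynomial.eval_pow]
      push_cast
      ring
    rw [hev] at hexpn
    have hm' : (m₃ n : ℝ) ≤ ((pm.eval n : ℕ) : ℝ) := by exact_mod_cast hpm n
    have hq' : (q n : ℝ) ≤ ((pq.eval n : ℕ) : ℝ) := by exact_mod_cast hpq n
    calc 1024 * (n : ℝ) ^ (c₃ + 1) * (m₃ n : ℝ) * (q n : ℝ)
        ≤ 1024 * (n : ℝ) ^ (c₃ + 1) * ((pm.eval n : ℕ) : ℝ) * ((pq.eval n : ℕ) : ℝ) := by gcongr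
      _ ≤ _ := hexpn
  have hQ0 : (0 : ℝ) < modulus n := by
    rw [← hQ]; positivity
  have hs0 : 0 < Real.sqrt (5 * n) := Real.sqrt_pos.2 (by positivity)
  have hX0 : 0 < Real.sqrt (5 * n) * rate₂ α n * modulus n := mul_pos (mul_pos hs0 hα₂pos) hQ0
  unfold advThreshold
  rw [mul_div_assoc', div_le_div_iff₀ hX0 (by norm_num : (0 : ℝ) < 2)]
  -- goal: `m₃ · 2 · 2 ≤ (1/(4 n^{c₃})) · (√(5n) α₂ Q)`; use `α₂ ≥ 1/(8nq)`, `√(5n) ≥ 1`, `Q = 4·2^{⌊d/2⌋}`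
  have hkey : (m₃ n : ℝ) * 2 * 2 * (4 * (n : ℝ) ^ c₃) * (8 * n * q n) ≤ (2 : ℝ) ^ (dim n / 2) := by
    calc (m₃ n : ℝ) * 2 * 2 * (4 * (n : ℝ) ^ c₃) * (8 * n * q n) = 128 * (n : ℝ) ^ (c₃ + 1) * (m₃ n) * (q n) := by ring
      _ ≤ 1024 * (n : ℝ) ^ (c₃ + 1) * (m₃ n : ℝ) * (q n : ℝ) := by
          have : (0 : ℝ) ≤ (n : ℝ) ^ (c₃ + 1) * (m₃ n) * (q n) := by positivity
          nlinarith
      _ ≤ _ := hexpn'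
  have h8 : (0 : ℝ) < 8 * n * q n := by positivity
  have hprod : 1 ≤ rate₂ α n * (8 * n * q n) := by
    have := mul_le_mul_of_nonneg_right hα₂ h8.le
    rwa [one_div_mul_cancel h8.ne'] at this
  have hX : (m₃ n : ℝ) * 2 * 2 * (4 * (n : ℝ) ^ c₃) ≤ Real.sqrt (5 * n) * rate₂ α n * modulus n := by
    calc (m₃ n : ℝ) * 2 * 2 * (4 * (n : ℝ) ^ c₃)
        ≤ (m₃ n : ℝ) * 2 * 2 * (4 * (n : ℝ) ^ c₃) * (rate₂ α n * (8 * n * q n)) :=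
          le_mul_of_one_le_right (by positivity) hprod
      _ = rate₂ α n * ((m₃ n : ℝ) * 2 * 2 * (4 * (n : ℝ) ^ c₃) * (8 * n * q n)) := by ring
      _ ≤ rate₂ α n * (2 : ℝ) ^ (dim n / 2) := mul_le_mul_of_nonneg_left hkey hα₂pos.le
      _ ≤ Real.sqrt (5 * n) * rate₂ α n * ((4 : ℝ) * (2 : ℝ) ^ (dim n / 2)) := by
          have h0 : (0 : ℝ) ≤ rate₂ α n * (2 : ℝ) ^ (dim n / 2) := by positivity
          nlinarith [mul_le_mul_of_nonneg_right hsqrt h0]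
      _ = Real.sqrt (5 * n) * rate₂ α n * modulus n := by rw [hQ]
  have hp4 : (0 : ℝ) < 4 * (n : ℝ) ^ c₃ := by positivity
  calc (m₃ n : ℝ) * 2 * 2 = ((m₃ n : ℝ) * 2 * 2 * (4 * (n : ℝ) ^ c₃)) * (1 / (4 * (n : ℝ) ^ c₃)) := by
        field_simp
    _ ≤ (Real.sqrt (5 * n) * rate₂ α n * modulus n) * (1 / (4 * (n : ℝ) ^ c₃)) := by gcongr
    _ = 1 / (4 * (n : ℝ) ^ c₃) * (Real.sqrt (5 * n) * rate₂ α n * modulus n) := by ring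

end Params

end BLPRS2013

end Literature.Computability.Cryptography

end
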